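import Mathlib
import Literature.AlgebraicGeometry.Resolution.PowerSeriesRegularLocal
import Literature.AlgebraicGeometry.Resolution.RegularLocalRingsUFD
import Literature.RingTheory.MvPowerSeries.CoordinateDivision
import Summits.ResolutionOfSingularities.ResolutionOfSingularities.Theorems.WeightedInvariantLocalWeightedDropNCResSettingDefs
import Summits.ResolutionOfSingularities.ResolutionOfSingularities.Theorems.WeightedInvariantLocalWeightedDropSpaceCountGameInvariance
import Summits.ResolutionOfSingularities.ResolutionOfSingularities.Theorems.WeightedInvariantLocalWeightedDropNCOrderGrowth

/-!
# `LocalWeightedDrop`, the NC count game — TOT2-LINE piece S-SET (2/4): **SQUAREFREE REPRESENTATIVES AND THE SLICED STRICT TRANSFORM**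

[OURS · L1 W4.3 · chain w43, engine crux `LocalWeightedDrop` stmt-ResolutionOfSingularities-8899; sub-line under the v32 registered stub
`stub_spaceNCRankDrop`, design memo `L/res-L1-w43-lead-1/g4/TOT2-LINE.md` v1 §2, piece S-SET = res-L1-w43-stub-1; the objects are those of
`…NCResSettingDefs` (p528587).  MODEL: Cossart–Jannsen–Saito LNM 2270 §3 in the hypersurface / count-game transcription; the order bound is
res-D-pv-036's `NCTransport.order_slice_add_le_of_factor` (p524604); the squarefree bookkeeping is Mathlib's `UniqueFactorizationMonoid.radical`
over the tree's «`k⟦x⟧` is a regular local ring, hence factorial» (`isRegularLocalRing_mvPowerSeries`, `IsRegularLocalRing.uniqueFactorizationMonoid`).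
Nothing here is a statement of any manuscript.]

* squarefree representatives: `exists_squarefree_radicalEquiv`, `squarefree_sqfRep`, `sqfRep_dvd`, `dvd_sqfRep_pow`, `order_sqfRep_le`, and
  THE DICHOTOMY `order_sqfRep_lt`: if `g ≠ 0` is not squarefree then `ord (sqfRep g) < ord g` (a non-reduced strict transform is a head drop);
* `exists_coeff_slice_subst_chart_eq_of_weight` (the weight-analogue of pv-036's key coefficient) ⇒ `not_X_zero_dvd_slice_of_factor`: in
  `F∘chart = s^A·G`, `s ∤ G`, at every live slot also `s ∤ G|_{y_i=0}` — THE EXCEPTIONAL DIVISOR IS NEVER A COMPONENT OF THE SLICED STRICT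
  TRANSFORM;
* for a decoration `δ` and a B-permissible move: `Decoration.fChart_eq` (the `s`-saturation), `Decoration.strict_ne_zero`,
  `Decoration.not_X_zero_dvd_strict`, `Decoration.satExp_fChart_eq_order` (`A_f = ord f` by equimultiplicity (P1)) and
  **(S3) `Decoration.order_strict_le`: `ord (strict transform) ≤ ord f`**.
-/

set_option linter.dupNamespace false -- mandated namespace of this single-conjunct summit

noncomputable section

namespace Summit.ResolutionOfSingularities.ResolutionOfSingularities.Theorems

namespace TameFourTupleDrop

open MvPowerSeries Literature.AlgebraicGeometry.Resolution

variable {k : Type} [Field k] {m : ℕ}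

/-! ## Factoriality of `k⟦x⟧` and squarefree representatives -/

/-- `k⟦x₀,…,x_{n-1}⟧` is factorial (regular local ⇒ UFD, both in the tree). -/
theorem uniqueFactorizationMonoid_mvPowerSeries (n : ℕ) : UniqueFactorizationMonoid (MvPowerSeries (Fin n) k) := by
  haveI := isRegularLocalRing_mvPowerSeries k (Fin n)
  exact IsRegularLocalRing.uniqueFactorizationMonoid (MvPowerSeries (Fin n) k)

/-- Every non-zero germ has a SQUAREFREE element in its radical class (its radical in the factorial ring `k⟦x⟧`). -/
theorem exists_squarefree_radicalEquiv {n : ℕ} {g : MvPowerSeries (Fin n) k} (hg : g ≠ 0) :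
    ∃ r : MvPowerSeries (Fin n) k, Squarefree r ∧ r ∣ g ∧ ∃ N : ℕ, g ∣ r ^ (N + 1) := by
  classical
  haveI := uniqueFactorizationMonoid_mvPowerSeries (k := k) n
  letI : StrongNormalizationMonoid (MvPowerSeries (Fin n) k) := UniqueFactorizationMonoid.strongNormalizationMonoid
  obtain ⟨N, hN⟩ := UniqueFactorizationMonoid.exists_dvd_radical_self_pow hg
  refine ⟨UniqueFactorizationMonoid.radical g, UniqueFactorizationMonoid.squarefree_radical,
    UniqueFactorizationMonoid.radical_dvd_self, N, hN.trans (pow_dvd_pow _ (Nat.le_succ N))⟩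

/-- The squarefree representative divides. -/
theorem sqfRep_dvd {n : ℕ} (g : MvPowerSeries (Fin n) k) : sqfRep g ∣ g := by
  by_cases hs : Squarefree g
  · rw [sqfRep_of_squarefree hs]
  · by_cases hg : g = 0
    · subst hg; exact dvd_zero _
    · exact (sqfRep_spec hs (exists_squarefree_radicalEquiv hg)).2.1

/-- The squarefree representative of a non-zero germ is squarefree. -/
theorem squarefree_sqfRep {n : ℕ} {g : MvPowerSeries (Fin n) k} (hg : g ≠ 0) : Squarefree (sqfRep g) := by
  by_cases hs : Squarefree g
  · rw [sqfRep_of_squarefree hs]; exact hs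
  · exact (sqfRep_spec hs (exists_squarefree_radicalEquiv hg)).1

/-- A power of the squarefree representative is a multiple of the germ. -/
theorem dvd_sqfRep_pow {n : ℕ} {g : MvPowerSeries (Fin n) k} (hg : g ≠ 0) : ∃ N : ℕ, g ∣ sqfRep g ^ (N + 1) := by
  by_cases hs : Squarefree g
  · rw [sqfRep_of_squarefree hs]; exact ⟨0, by rw [zero_add, pow_one]⟩
  · exact (sqfRep_spec hs (exists_squarefree_radicalEquiv hg)).2.2

/-- The squarefree representative of a non-zero germ is non-zero. -/
theorem sqfRep_ne_zero {n : ℕ} {g : MvPowerSeries (Fin n) k} (hg : g ≠ 0) : sqfRep g ≠ 0 :=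
  (squarefree_sqfRep hg).ne_zero

/-- A divisor has smaller order. -/
theorem order_le_order_of_dvd {n : ℕ} {a b : MvPowerSeries (Fin n) k} (h : a ∣ b) : a.order ≤ b.order := by
  obtain ⟨t, rfl⟩ := h
  exact le_trans (le_add_right le_rfl) (le_order_mul)

/-- `ord (sqfRep g) ≤ ord g`. -/
theorem order_sqfRep_le {n : ℕ} (g : MvPowerSeries (Fin n) k) : (sqfRep g).order ≤ g.order :=
  order_le_order_of_dvd (sqfRep_dvd g)

/-- THE DICHOTOMY BEHIND (Q4): if a non-zero germ is NOT squarefree, its squarefree representative has STRICTLY smaller order (a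
non-reduced strict transform is a head drop, so inside a fundamental unit the representative IS the actual strict transform). -/
theorem order_sqfRep_lt {n : ℕ} {g : MvPowerSeries (Fin n) k} (hg : g ≠ 0) (hs : ¬ Squarefree g) : (sqfRep g).order < g.order := by
  obtain ⟨t, ht⟩ := sqfRep_dvd g
  have hr0 : sqfRep g ≠ 0 := sqfRep_ne_zero hg
  -- `t` is not a unit, else `g` would be squarefree
  have ht1 : ¬ IsUnit t := by
    intro hu
    apply hs
    have hdvd : g ∣ sqfRep g := by
      refine ⟨↑hu.unit⁻¹, ?_⟩
      conv_rhs => rw [ht]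
      rw [mul_assoc, IsUnit.mul_val_inv, mul_one]
    exact (squarefree_sqfRep hg).squarefree_of_dvd hdvd
  have htord : t.order ≠ 0 := by
    rw [order_ne_zero_iff_constCoeff_eq_zero]
    by_contra hne
    exact ht1 (isUnit_iff_constantCoeff.mpr (Ne.isUnit hne))
  have hfin : (sqfRep g).order ≠ ⊤ := by rwa [ne_eq, order_eq_top_iff]
  have hord : g.order = (sqfRep g).order + t.order := by
    have h := congrArg MvPowerSeries.order ht
    rwa [order_mul] at h
  rw [hord]
  obtain ⟨a, ha⟩ := ENat.ne_top_iff_exists.mp hfin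
  rw [← ha]
  have h1 : (1 : ℕ∞) ≤ t.order := Order.one_le_iff_ne_zero.mpr htord
  calc (a : ℕ∞) < a + 1 := by exact_mod_cast Nat.lt_succ_self a
    _ ≤ a + t.order := add_le_add le_rfl h1

/-! ## The exceptional letter does not divide the sliced strict transform

The computational core is the weight-analogue of res-D-pv-036's key coefficient (`NCTransport.exists_coeff_slice_subst_chart_eq`): among the
exponents of `F` of MINIMAL `w`-WEIGHT `A` take `d⋆` with `d⋆_{i₀}` minimal; the coefficient of `s^A · y^{d⋆ off i₀}` in the sliced
transform is the single term `F_{d⋆} · c_{i₀}^{d⋆_{i₀}} ≠ 0`, so the sliced `s`-free part has a non-zero coefficient at `s`-exponent `0`. -/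

/-- For weights `w_l ≤ 1` the `w`-weight is the sum of the entries on the weight-`1` slots. -/
theorem weight_eq_sum_filter_one {n : ℕ} {w : Fin n → ℕ} (hw : ∀ l, w l ≤ 1) (d : Fin n →₀ ℕ) :
    Finsupp.weight w d = ∑ l ∈ Finset.univ.filter (fun l => w l = 1), d l := by
  classical
  rw [Finsupp.weight_apply, Finsupp.sum_fintype _ _ (fun _ => by simp), Finset.sum_filter]
  refine Finset.sum_congr rfl fun l _ => ?_
  rcases Nat.le_one_iff_eq_zero_or_eq_one.mp (hw l) with h | h
  · simp [h]
  · simp [h]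

/-- THE KEY COEFFICIENT AT MINIMAL WEIGHT.  For `F ≠ 0` of `w`-order `A`, weights `w ≤ 1` with the chart convention and a live slot `i₀`
(`c_{i₀} ≠ 0`): there is an exponent `d⋆` of `F` of weight `A` such that the coefficient of `s^A · y^{d⋆ off i₀}` in
`(F ∘ chart_{w,c})|_{y_{i₀} = 0}` is `F_{d⋆} · c_{i₀}^{d⋆_{i₀}}` (in particular non-zero). -/
theorem exists_coeff_slice_subst_chart_eq_of_weight {n : ℕ} (w : Fin (n + 1) → ℕ) (c : Fin (n + 1) → k)
    (hc : ∀ l, w l = 0 → c l = 0) (hw : ∀ l, w l ≤ 1) {i₀ : Fin (n + 1)} (hci : c i₀ ≠ 0)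
    {F : MvPowerSeries (Fin (n + 1)) k} {A : ℕ} (hA : F.weightedOrder w = A) :
    ∃ (dstar : Fin (n + 1) →₀ ℕ) (τ : Fin n →₀ ℕ), coeff dstar F ≠ 0 ∧ Finsupp.weight w dstar = A ∧
      coeff (Finsupp.cons A τ) (TupleGame.slice i₀ (subst (CobordantChart.chart w c) F)) = coeff dstar F * c i₀ ^ dstar i₀ := by
  classical
  obtain ⟨⟨d₀, hd₀, hwd₀⟩, -⟩ := (weightedOrder_eq_nat (w := w) (f := F)).mp hA
  -- `d⋆`: minimal `i₀`-entry among the weight-`A` exponents of `F`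
  have hex : ∃ N, ∃ d : Fin (n + 1) →₀ ℕ, coeff d F ≠ 0 ∧ Finsupp.weight w d = A ∧ d i₀ = N := ⟨_, d₀, hd₀, hwd₀, rfl⟩
  obtain ⟨dstar, hdstarF, hdstarw, hdstarN⟩ := Nat.find_spec hex
  have hmin : ∀ d : Fin (n + 1) →₀ ℕ, coeff d F ≠ 0 → Finsupp.weight w d = A → dstar i₀ ≤ d i₀ := fun d hd hwd => by
    rw [hdstarN]; exact Nat.find_min' hex ⟨d, hd, hwd, rfl⟩
  -- `τ` := `d⋆` off `i₀`
  let τ : Fin n →₀ ℕ := Finsupp.equivFunOnFinite.symm fun j => dstar (i₀.succAbove j)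
  have hτ : ∀ l, l ≠ i₀ → Finsupp.mapDomain i₀.succAbove τ l = dstar l := fun l hl =>
    CoeffTransport.mapDomain_succAbove_comap i₀ dstar l hl
  have hτ0 : Finsupp.mapDomain i₀.succAbove τ i₀ = 0 := CoeffTransport.mapDomain_succAbove_apply_self i₀ τ
  refine ⟨dstar, τ, hdstarF, hdstarw, ?_⟩
  unfold TupleGame.slice
  rw [CobordantChartPlaneSlice.coeff_subst_slice, CoeffTransport.mapDomain_succ_succAbove_cons,
    CobordantChart.coeff_subst_chart w c hc, finsum_eq_single _ dstar]
  · rw [if_pos hdstarw, Finset.prod_eq_single i₀]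
    · rw [hτ0, Nat.choose_zero_right, Nat.cast_one, one_mul, Nat.sub_zero]
    · intro l _ hl
      rw [hτ l hl, Nat.choose_self, Nat.cast_one, one_mul, Nat.sub_self, pow_zero]
    · intro h; exact absurd (Finset.mem_univ i₀) h
  · intro d hd
    split_ifs with hwt
    · by_cases hdF : coeff d F = 0
      · rw [hdF, zero_mul]
      · -- unless some binomial factor dies, `d = d⋆`
        suffices h : ∃ l, (((d l).choose (Finsupp.mapDomain i₀.succAbove τ l) : k) *
            c l ^ (d l - Finsupp.mapDomain i₀.succAbove τ l)) = 0 by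
          obtain ⟨l, hl⟩ := h
          rw [Finset.prod_eq_zero (Finset.mem_univ l) hl, mul_zero]
        by_contra hall
        push Not at hall
        -- (a) `d ≥ d⋆` off `i₀`
        have hge : ∀ l, l ≠ i₀ → dstar l ≤ d l := by
          intro l hl
          rw [← hτ l hl]
          by_contra hlt
          push Not at hlt
          exact hall l (by rw [Nat.choose_eq_zero_of_lt hlt, Nat.cast_zero, zero_mul])
        -- (b) `d = d⋆` on the slots with `c_l = 0`, in particular on the weight-`0` slots
        have heq0 : ∀ l, c l = 0 → d l = dstar l := by
          intro l hcl
          have hl : l ≠ i₀ := by rintro rfl; exact hci hcl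
          refine le_antisymm ?_ (hge l hl)
          rw [← hτ l hl]
          by_contra hlt
          push Not at hlt
          exact hall l (by rw [hcl, zero_pow (Nat.sub_ne_zero_of_lt hlt), mul_zero])
        -- (c) minimality: `d⋆ i₀ ≤ d i₀`, so `d ≥ d⋆` everywhere
        have hi₀ : dstar i₀ ≤ d i₀ := hmin d hdF hwt
        have hall' : ∀ l, dstar l ≤ d l := fun l => by
          by_cases hl : l = i₀
          · rw [hl]; exact hi₀
          · exact hge l hl
        -- (d) equal weights force `d = d⋆` on the weight-`1` slots; the weight-`0` slots are covered by (b)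
        apply hd
        have hsum : ∑ l ∈ Finset.univ.filter (fun l => w l = 1), dstar l = ∑ l ∈ Finset.univ.filter (fun l => w l = 1), d l := by
          rw [← weight_eq_sum_filter_one hw, ← weight_eq_sum_filter_one hw, hdstarw, hwt]
        ext l
        rcases Nat.le_one_iff_eq_zero_or_eq_one.mp (hw l) with h0 | h1
        · exact heq0 l (hc l h0)
        · have hmem : l ∈ Finset.univ.filter (fun l => w l = 1) := Finset.mem_filter.mpr ⟨Finset.mem_univ l, h1⟩
          exact ((Finset.sum_eq_sum_iff_of_le fun l _ => hall' l).mp hsum l hmem).symm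
    · rfl

/-- **THE EXCEPTIONAL LETTER DOES NOT DIVIDE THE SLICED STRICT TRANSFORM** (OURS · L1 W4.3, S-SET): in the `s`-saturation
`F ∘ chart_{w,c} = s^A · G`, `s ∤ G` of a non-zero `F` (weights `≤ 1`, chart convention), at every live slot `i₀` also `s ∤ G|_{y_{i₀} = 0}`
(the exceptional divisor is never a component of the strict transform). -/
theorem not_X_zero_dvd_slice_of_factor {n : ℕ} {w : Fin (n + 1) → ℕ} {c : Fin (n + 1) → k} (hc : ∀ l, w l = 0 → c l = 0)
    (hw : ∀ l, w l ≤ 1) {i₀ : Fin (n + 1)} (hci : c i₀ ≠ 0) {F : MvPowerSeries (Fin (n + 1)) k} (hF : F ≠ 0) {A : ℕ}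
    {G : MvPowerSeries (Fin (n + 1 + 1)) k} (hfac : subst (CobordantChart.chart w c) F = X 0 ^ A * G) (hG : ¬ X 0 ∣ G) :
    ¬ X 0 ∣ TupleGame.slice i₀ G := by
  have hA : F.weightedOrder w = A := (CobordantChart.eq_weightedOrder_of_factor w c hc hF hfac hG).symm
  obtain ⟨dstar, τ, hdstarF, -, hcoeff⟩ := exists_coeff_slice_subst_chart_eq_of_weight w c hc hw hci hA
  have hsl : TupleGame.slice i₀ (subst (CobordantChart.chart w c) F) = X 0 ^ A * TupleGame.slice i₀ G := by
    rw [hfac, NCTransport.slice_X_zero_pow_mul']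
  intro hdvd
  have h0 : coeff (Finsupp.cons 0 τ) (TupleGame.slice i₀ G) = 0 := X_dvd_iff.mp hdvd _ (Finsupp.cons_zero _ _)
  have h1 := CobordantChart.coeff_cons_of_eq_X_pow_mul hsl 0 τ
  rw [add_zero, hcoeff, h0] at h1
  exact mul_ne_zero hdstarF (pow_ne_zero _ hci) h1.symm

/-! ## The sliced strict transform of the equation -/

section Strict

variable {δ : Decoration k m} {Φ : Fin (m + 1) → MvPowerSeries (Fin (m + 1)) k} {w : Fin (m + 1) → ℕ} {c : Fin (m + 1) → k}

/-- A legal coordinate change is injective on germs. -/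
theorem subst_ne_zero_of_isCountMove (hmv : IsCountMove Φ w) {f : MvPowerSeries (Fin (m + 1)) k} (hf : f ≠ 0) :
    subst Φ f ≠ 0 :=
  FormalCoordChange.subst_ne_zero_of_isUnit_det hmv.1 hmv.2.1 hf

/-- The chart transform of a non-zero equation is non-zero. -/
theorem Decoration.fChart_ne_zero (hmv : IsCountMove Φ w) (hc : ∀ l, w l = 0 → c l = 0) (hf : δ.f ≠ 0) :
    δ.fChart Φ w c ≠ 0 :=
  CobordantChart.subst_chart_ne_zero w c hc (subst_ne_zero_of_isCountMove hmv hf)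

/-- The `s`-saturation of the chart transform of the equation. -/
theorem Decoration.fChart_eq (hmv : IsCountMove Φ w) (hc : ∀ l, w l = 0 → c l = 0) (hf : δ.f ≠ 0) :
    subst (CobordantChart.chart w c) (subst Φ δ.f) = X 0 ^ satExp (δ.fChart Φ w c) * satPart (δ.fChart Φ w c) ∧
      ¬ X 0 ∣ satPart (δ.fChart Φ w c) :=
  satExp_satPart_spec (Decoration.fChart_ne_zero hmv hc hf)

/-- The sliced strict transform at a live slot is non-zero. -/
theorem Decoration.strict_ne_zero (hmv : IsCountMove Φ w) (hc : ∀ l, w l = 0 → c l = 0) (hf : δ.f ≠ 0) {i : Fin (m + 1)}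
    (hci : c i ≠ 0) : δ.strict Φ w c i ≠ 0 :=
  TupleDropAssembly.slice_ne_zero (subst Φ δ.f) w c hc hmv.2.2.1 _ _ (Decoration.fChart_eq hmv hc hf).1
    (Decoration.fChart_eq hmv hc hf).2 i hci

/-- THE EXCEPTIONAL LETTER DOES NOT DIVIDE THE SLICED STRICT TRANSFORM of the equation. -/
theorem Decoration.not_X_zero_dvd_strict (hmv : IsCountMove Φ w) (hc : ∀ l, w l = 0 → c l = 0) (hf : δ.f ≠ 0)
    {i : Fin (m + 1)} (hci : c i ≠ 0) : ¬ X 0 ∣ δ.strict Φ w c i :=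
  not_X_zero_dvd_slice_of_factor hc hmv.2.2.1 hci (subst_ne_zero_of_isCountMove hmv hf) (Decoration.fChart_eq hmv hc hf).1
    (Decoration.fChart_eq hmv hc hf).2

/-- In the `s`-saturation of a B-PERMISSIBLE move the exponent is the order: `A_f = ord f` (equimultiplicity (P1) says the `w`-order of
`f∘Φ` is its order, and the exponent is the `w`-order). -/
theorem Decoration.satExp_fChart_eq_order (hperm : IsBPermissible δ Φ w) (hc : ∀ l, w l = 0 → c l = 0) (hf : δ.f ≠ 0) :
    (satExp (δ.fChart Φ w c) : ℕ∞) = δ.f.order := by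
  obtain ⟨hmv, hP1, -, -⟩ := hperm
  have hA := CobordantChart.eq_weightedOrder_of_factor w c hc (subst_ne_zero_of_isCountMove hmv hf) (Decoration.fChart_eq hmv hc hf).1
    (Decoration.fChart_eq hmv hc hf).2
  have hord : (subst Φ δ.f).order = δ.f.order := NCTransport.order_subst_eq_of_isUnit_det hmv.1 hmv.2.1 δ.f
  rw [hA, ← hord]
  refine le_antisymm (le_order fun d hd => coeff_eq_zero_of_lt_weightedOrder w ?_) hP1
  exact lt_of_le_of_lt (by exact_mod_cast NCTransport.weight_le_degree_of_le_one hmv.2.2.1 d) hd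

/-- **(S3) THE ORDER DOES NOT INCREASE**: under a B-permissible move the sliced strict transform at a live slot has order `≤ ord f`
(res-D-pv-036's growth bound `ord (G|) + A ≤ 2 · ord (f∘Φ)` with `A = ord f` by equimultiplicity). -/
theorem Decoration.order_strict_le (hperm : IsBPermissible δ Φ w) (hc : ∀ l, w l = 0 → c l = 0) (hf : δ.f ≠ 0)
    {i : Fin (m + 1)} (hci : c i ≠ 0) : (δ.strict Φ w c i).order ≤ δ.f.order := by
  have hmv := hperm.1
  have hgrow := NCTransport.order_slice_add_le_of_factor hc hmv.2.2.1 hci (Decoration.fChart_eq hmv hc hf).1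
  have hA := Decoration.satExp_fChart_eq_order hperm hc hf
  have hord : (subst Φ δ.f).order = δ.f.order := NCTransport.order_subst_eq_of_isUnit_det hmv.1 hmv.2.1 δ.f
  rw [hord, hA, two_mul] at hgrow
  have hfin : δ.f.order ≠ ⊤ := by rw [ne_eq, order_eq_top_iff]; exact hf
  exact (ENat.add_le_add_iff_right hfin).mp hgrow

end Strict

end TameFourTupleDrop

end Summit.ResolutionOfSingularities.ResolutionOfSingularities.Theorems

end
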